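import Literature.NumberTheory.Transcendental.KZProductIdeal
import Literature.NumberTheory.Transcendental.KZLogCalculusProofs
import Literature.NumberTheory.Transcendental.KZDominatedFamilyRelations
import Literature.NumberTheory.Transcendental.KZMellinFibres

/-!
# `NormalFormPrinciple` (stmt-KontsevichZagierPeriods-3869), line `SketchIdeator1` — stub `stub_boxPiStable`

The box-rational family of the Kontsevich–Zagier calculus (representations whose domain is the
OPEN unit box `(0,1)ᵐ` and whose integrand is a quotient `p/q` of `ℚ`-polynomials on it, `q ≠ 0`
there) is stable under "multiplication by `π`" in the following product form. Let
`κ = [[0,1], du/((1−u)²+u²)]` be the bounded arctangent kernel (`∫₀¹ du/((1−u)²+u²) = π/2`). For a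
box-rational `N` in dimension `m`, twice the product representation `N × κ`
(`KZ.IntegralRep.prod`, domain `(0,1)ᵐ × [0,1]`, integrand `f ⊗ κ` by
`KZ.IntegralRep.prod_integrand_eq`) is congruent modulo `KZ.relations` to ONE box-rational
representation `N'` in dimension `m + 1`:

* `2 • [σ, h] ≡ [σ, 2h]` is one integrand-additivity move (rule 1b));
* `(0,1)ᵐ × [0,1]` differs from the open box `(0,1)ᵐ⁺¹` by the two faces `u = 0`, `u = 1`, which
  are Lebesgue-null coordinate hyperplanes, so restricting to the open box is a relation
  (rule 1a), `KZ.IntegralRep.of_sub_of_restrict_mem_relations`);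
* on the open box the integrand is `2 p(x) / (q(x) · ((1−u)² + u²))`, a quotient of
  `ℚ`-polynomials in `m + 1` variables whose denominator does not vanish (`q ≠ 0` on `(0,1)ᵐ`,
  `(1−u)² + u² ≥ 1/2`).

Sources: Kontsevich–Zagier 2001, §1.1 (the `π` chain) and §1.2 (rules 1a), 1b)).
-/

noncomputable section

open MeasureTheory Set
open Literature.NumberTheory.Transcendental Literature.NumberTheory.Transcendental.KZ
open Literature.ModelTheory.ExponentialFields (IsSemialgebraic)

namespace Summit.KontsevichZagierPeriods.HurwitzMicroSectors.NormalFormPrinciple.PiBox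

namespace stub_boxPiStableAux

variable {n : ℕ}

/-- The product of a representation `[D, g]` with the calibration kernel
`κ = [[0,1], du/((1−u)²+u²)]` has domain `D × [0,1]` (last coordinate in `[0,1]`) and integrand
`g(x)/((1−u)²+u²)`. [folklore] -/
theorem prod_kappa_eq (s : IntegralRep n) (κ : IntegralRep 1)
    (hκd : κ.domain = {x | x 0 ∈ Set.Icc (0:ℝ) 1})
    (hκi : κ.integrand = (fun x => 1 / ((1 - x 0) ^ 2 + x 0 ^ 2))) :
    (s.prod κ).domain = {z : Fin (n + 1) → ℝ | (Fin.init z : Fin n → ℝ) ∈ s.domain ∧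
      z (Fin.last n) ∈ Set.Icc (0:ℝ) 1} ∧
    (s.prod κ).integrand = fun z => s.integrand (Fin.init z) *
      (1 / ((1 - z (Fin.last n)) ^ 2 + z (Fin.last n) ^ 2)) := by
  -- adapted from the lead's `prod_kappa_eq` (work/NormalFormPrinciple.lean)
  have hinit : ∀ z : Fin (n + 1) → ℝ, (fun i => z (Fin.castAdd 1 i)) = Fin.init z := fun z => rfl
  have hlast : ∀ z : Fin (n + 1) → ℝ, z (Fin.natAdd n (0 : Fin 1)) = z (Fin.last n) := fun z => by
    congr 1
  constructor
  · ext z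
    simp only [IntegralRep.prod_domain, IntegralRep.mem_prodDomain, hκd, mem_setOf_eq, hinit,
      hlast]
  · rw [IntegralRep.prod_integrand_eq]
    funext z
    rw [IntegralRep.prodFun_apply, hκi, hinit]
    simp only [hlast]

/-- **Doubling the integrand** (rule 1b)): for every representation `r = [σ, f]` the
representation `R = [σ, f + f]` exists and `[R] − [r] − [r] ∈ relations`. [folklore] -/
theorem exists_double (r : IntegralRep n) :
    ∃ R : IntegralRep n, R.domain = r.domain ∧ R.integrand = r.integrand + r.integrand ∧
      of R - of r - of r ∈ relations := by
  let R : IntegralRep n :=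
    { domain := r.domain
      integrand := r.integrand + r.integrand
      isSemialgebraic_domain := r.isSemialgebraic_domain
      isSemialgebraicFunOn_integrand :=
        IsSemialgebraicFunOn.add_holds r.isSemialgebraicFunOn_integrand
          r.isSemialgebraicFunOn_integrand
      integrableOn := r.integrableOn.add r.integrableOn }
  exact ⟨R, rfl, rfl,
    integrandAddRel_subset_relations ⟨n, R, r, r, rfl, rfl, fun _ _ => rfl, rfl⟩⟩

/-- The band `(0,1)ⁿ × [0,1]` minus the open box `(0,1)ⁿ⁺¹` lies in the two faces `u = 0`,
`u = 1` of the last coordinate. [folklore] -/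
theorem band_diff_box_subset (z : Fin (n + 1) → ℝ)
    (hzi : ∀ i : Fin n, Fin.init z i ∈ Set.Ioo (0:ℝ) 1)
    (hzl : z (Fin.last n) ∈ Set.Icc (0:ℝ) 1)
    (hzb : ¬ ∀ i, z i ∈ Set.Ioo (0:ℝ) 1) :
    z (Fin.last n) = 0 ∨ z (Fin.last n) = 1 := by
  by_contra h
  rw [not_or] at h
  refine hzb fun i => Fin.lastCases ?_ (fun j => hzi j) i
  exact ⟨lt_of_le_of_ne hzl.1 (Ne.symm h.1), lt_of_le_of_ne hzl.2 h.2⟩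

end stub_boxPiStableAux

open stub_boxPiStableAux in
/-- **The box-rational family is `π`-stable** (product half): for a box-rational `N` (domain the
open unit box, integrand `p/q` on it) and the calibration kernel `κ = [[0,1], du/((1−u)²+u²)]`,
`2•[N × κ]` is congruent to a box-rational representation one dimension up: `2•[σ, h] ≡ [σ, 2h]`
(rule 1b)), the product domain `(0,1)ᵐ × [0,1]` is the open box up to the null faces `u ∈ {0,1}`
(rule 1a)), and `2 p(x)/(q(x)((1−u)²+u²))` is rational with non-vanishing denominator on the open
box (the product integrand is `f ⊗ κ` by `IntegralRep.prod_integrand_eq`).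
[cite: KontsevichZagier2001, §1.2] -/
theorem stub_boxPiStable :
    ∀ (m : ℕ) (N : IntegralRep m) (κ : IntegralRep 1),
      N.domain = {x | ∀ i, x i ∈ Set.Ioo (0:ℝ) 1} → N.IsRational →
      κ.domain = {x | x 0 ∈ Set.Icc (0:ℝ) 1} →
      κ.integrand = (fun x => 1 / ((1 - x 0) ^ 2 + x 0 ^ 2)) →
      ∃ N' : IntegralRep (m + 1), N'.domain = {x | ∀ i, x i ∈ Set.Ioo (0:ℝ) 1} ∧ N'.IsRational ∧
        2 • of (N.prod κ) - of N' ∈ relations := by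
  intro m N κ hNd hNr hκd hκi
  obtain ⟨hPd, hPi⟩ := prod_kappa_eq N κ hκd hκi
  obtain ⟨R, hRd, hRi, hR⟩ := exists_double (N.prod κ)
  -- the open box sits inside the band `(0,1)ᵐ × [0,1]`, with null complement
  have hsub : {x : Fin (m + 1) → ℝ | ∀ i, x i ∈ Set.Ioo (0:ℝ) 1} ⊆ R.domain := by
    intro z hz
    rw [hRd, hPd, hNd]
    exact ⟨fun i => hz (Fin.castSucc i), Ioo_subset_Icc_self (hz (Fin.last m))⟩
  have hnull : volume (R.domain \ {x : Fin (m + 1) → ℝ | ∀ i, x i ∈ Set.Ioo (0:ℝ) 1}) = 0 := by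
    refine measure_mono_null (fun z hz => ?_)
      (measure_union_null (volume_setOf_last_eq_zero (n := m) 0)
        (volume_setOf_last_eq_zero (n := m) 1))
    rw [hRd, hPd, hNd] at hz
    simp only [Set.mem_sdiff, mem_setOf_eq] at hz
    simp only [mem_union, mem_setOf_eq]
    exact band_diff_box_subset z hz.1.1 hz.1.2 hz.2
  refine ⟨R.restrict _ (isSemialgebraic_box (m + 1)) hsub, rfl, ?_, ?_⟩
  · -- rational shape on the open box
    obtain ⟨p, q, hq, hpq⟩ := hNr
    refine ⟨2 * MvPolynomial.rename Fin.castSucc p,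
      MvPolynomial.rename Fin.castSucc q *
        ((1 - MvPolynomial.X (Fin.last m)) ^ 2 + MvPolynomial.X (Fin.last m) ^ 2), ?_, ?_⟩
    · intro z hz
      have hz' : ∀ i, z i ∈ Set.Ioo (0:ℝ) 1 := hz
      have hzi : Fin.init z ∈ N.domain := by
        rw [hNd]
        exact fun i => hz' (Fin.castSucc i)
      have hden : (0:ℝ) < (1 - z (Fin.last m)) ^ 2 + z (Fin.last m) ^ 2 := by
        nlinarith [sq_nonneg (z (Fin.last m) - 1 / 2)]
      have hcomp : (z ∘ Fin.castSucc) = Fin.init z := rfl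
      simp only [map_mul, map_add, map_pow, map_sub, map_one, MvPolynomial.aeval_X,
        MvPolynomial.aeval_rename, hcomp]
      exact mul_ne_zero (hq _ hzi) hden.ne'
    · intro z hz
      have hz' : ∀ i, z i ∈ Set.Ioo (0:ℝ) 1 := hz
      have hzi : Fin.init z ∈ N.domain := by
        rw [hNd]
        exact fun i => hz' (Fin.castSucc i)
      have hqz : MvPolynomial.aeval (Fin.init z) q ≠ 0 := hq _ hzi
      have hden : (1 - z (Fin.last m)) ^ 2 + z (Fin.last m) ^ 2 ≠ 0 := by
        have : (0:ℝ) < (1 - z (Fin.last m)) ^ 2 + z (Fin.last m) ^ 2 := by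
          nlinarith [sq_nonneg (z (Fin.last m) - 1 / 2)]
        exact this.ne'
      have hcomp : (z ∘ Fin.castSucc) = Fin.init z := rfl
      show R.integrand z = _
      rw [hRi, Pi.add_apply, hPi]
      simp only [map_mul, map_add, map_pow, map_sub, map_one, map_ofNat, MvPolynomial.aeval_X,
        MvPolynomial.aeval_rename, hcomp]
      rw [hpq hzi]
      field_simp
      ring
  · -- `2•[N × κ] ≡ [R] ≡ [N']`
    have h2 : of R - of (R.restrict _ (isSemialgebraic_box (m + 1)) hsub) ∈ relations :=
      IntegralRep.of_sub_of_restrict_mem_relations R (isSemialgebraic_box (m + 1)) hsub hnull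
    have : 2 • of (N.prod κ) - of (R.restrict _ (isSemialgebraic_box (m + 1)) hsub) =
        (of R - of (R.restrict _ (isSemialgebraic_box (m + 1)) hsub)) -
          (of R - of (N.prod κ) - of (N.prod κ)) := by
      rw [two_nsmul]; abel
    rw [this]
    exact relations.sub_mem h2 hR

end Summit.KontsevichZagierPeriods.HurwitzMicroSectors.NormalFormPrinciple.PiBox
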